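import Literature.IUT.HodgeTheaters.ConventionsCatIsomorphismGroup
import HarnessLib

/-!
# [IUTchI] §0 / Cor 5.3: at a ONE-OBJECT KIND the model case of Corollary 5.3 IS «`Aut(𝒞) → Aut(𝒟)` bijective»
# (proof-only; row T2 «FKIT-SLOT-OF-DESCEND» of HOME/staging/L5/L5-t4/g6/STEP0-GenuineFKit-OneObject-g6.md)

S. Mochizuki, *Inter-universal Teichmüller theory I*, kurims manuscript (May 2020), §0 p. 33 («an isomorphism
class of equivalences between two categories = an isomorphism between the two categories»), §5 Corollary 5.3
p. 144 («the natural map `Isom(¹𝔉, ²𝔉) → Isom(¹𝔇, ²𝔇)` is bijective», «the natural homomorphism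
`Aut(ℱ̲_v) → Aut(𝒟_v)` is bijective») ([IUTchI] Cor 5.3 p.144) [claim: Mochizuki2012, status: disputed] (D-0012
claim key; nothing of the series asserted; no side taken on [IUTchIII] Cor. 3.12).

PROOF-ONLY companion (theorems only, no `def`) of `ConventionsCatIsomorphismGroup.lean` (abc-iut-L5-t4 g6):
abc-iut-L5-t4's `FKit.isomFtoDBijective_iff_model` (p409092) reduces cone node `IUTchI:Cor5.3(ii)` to the MODEL
CASE «`α ↦ (toD v)(α)` is bijective on automorphisms of the reference object `ℱ_v`» at each slot.  When the slot
is the ONE-OBJECT KIND `SingleObj (Aut(𝒞_v))` (reference object = the unique object) and the base functor is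
`CatIsomorphism.kindFunctor he hu` (the passage `𝒞 ↦ Base(𝒞)` on isomorphisms of categories, [FrdI] Cor 4.11
(i)/(iv) entering as the displayed binders `he : HasUnder p p`, `hu : UnderUnique p p`), that model case is
LITERALLY `CatIsomorphism.DescendBijective p p he hu` — «the natural map `Aut(𝒞_v) → Aut(𝒟_v)` is bijective»
(`mapIso_kindFunctor_bijective_iff`); injectivity halves correspond likewise (`mapIso_kindFunctor_injective_iff`),
which is the form the rigidity rows (S2 [FrdI] self-equivalence rigidity, N1/N2/N3 pair rigidity) deliver.
Underlying folklore: for a group homomorphism `f : G →* H`, `SingleObj.mapHom f` is bijective (resp. injective)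
on automorphisms of the unique object iff `f` is (`mapIso_mapHom_bijective_iff`, `…_injective_iff`), via Mathlib's
`Units.toAut ∘ toUnits : G ≃ Aut(⋆)`.
-/

namespace Literature.IUT.HodgeTheaters

open CategoryTheory

universe w₁ w₂ v₁ v₂ v₃ v₄ u₁ u₂

namespace CatIsomorphism

section KindSlot

/-- The functor of a group homomorphism acts on automorphisms of the unique object as the homomorphism,
transported along Mathlib's `G ≃ Aut(⋆)` (`toUnits.trans (Units.toAut G)`). [folklore] -/
private theorem mapIso_mapHom_toAut {G : Type w₁} {H : Type w₂} [Group G] [Group H] (f : G →* H) (g : G) :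
    (SingleObj.mapHom G H f).mapIso ((toUnits.trans (Units.toAut G)).toEquiv g) =
      (toUnits.trans (Units.toAut H)).toEquiv (f g) := by
  ext
  rfl

/-- **Bijectivity on automorphisms of the one-object kind = bijectivity of the homomorphism.**  For a group
homomorphism `f : G →* H`, the map `α ↦ (SingleObj.mapHom f)(α)` on automorphisms of the unique object is
bijective iff `f` is — the bookkeeping behind reading §0's `Aut(C)` ("isomorphisms `C → C`", p. 33) as the
automorphism group of the unique object of the one-object kind. ([IUTchI] §0 p.33) [claim: Mochizuki2012, status: disputed] -/
theorem mapIso_mapHom_bijective_iff {G : Type w₁} {H : Type w₂} [Group G] [Group H] (f : G →* H) :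
    Function.Bijective
        (fun α : SingleObj.star G ≅ SingleObj.star G =>
          (show SingleObj.star H ≅ SingleObj.star H from (SingleObj.mapHom G H f).mapIso α)) ↔
      Function.Bijective f := by
  set eG : G ≃ (SingleObj.star G ≅ SingleObj.star G) := (toUnits.trans (Units.toAut G)).toEquiv with heG
  set eH : H ≃ (SingleObj.star H ≅ SingleObj.star H) := (toUnits.trans (Units.toAut H)).toEquiv with heH
  set F : (SingleObj.star G ≅ SingleObj.star G) → (SingleObj.star H ≅ SingleObj.star H) :=
    fun α => (SingleObj.mapHom G H f).mapIso α with hF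
  have h1 : ∀ g, F (eG g) = eH (f g) := fun g => mapIso_mapHom_toAut f g
  have hf : (f : G → H) = eH.symm ∘ F ∘ eG := by
    funext g
    simp only [Function.comp_apply, h1, Equiv.symm_apply_apply]
  have hF' : F = eH ∘ f ∘ eG.symm := by
    funext α
    obtain ⟨g, rfl⟩ := eG.surjective α
    simp only [Function.comp_apply, Equiv.symm_apply_apply, h1]
  constructor
  · intro h
    rw [hf]
    exact eH.symm.bijective.comp (h.comp eG.bijective)
  · intro h
    rw [hF']
    exact eH.bijective.comp (h.comp eG.symm.bijective)

/-- Injectivity version of `mapIso_mapHom_bijective_iff` (same §0 reading of `Aut(C)`).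
([IUTchI] §0 p.33) [claim: Mochizuki2012, status: disputed] -/
theorem mapIso_mapHom_injective_iff {G : Type w₁} {H : Type w₂} [Group G] [Group H] (f : G →* H) :
    Function.Injective
        (fun α : SingleObj.star G ≅ SingleObj.star G =>
          (show SingleObj.star H ≅ SingleObj.star H from (SingleObj.mapHom G H f).mapIso α)) ↔
      Function.Injective f := by
  set eG : G ≃ (SingleObj.star G ≅ SingleObj.star G) := (toUnits.trans (Units.toAut G)).toEquiv with heG
  set eH : H ≃ (SingleObj.star H ≅ SingleObj.star H) := (toUnits.trans (Units.toAut H)).toEquiv with heH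
  set F : (SingleObj.star G ≅ SingleObj.star G) → (SingleObj.star H ≅ SingleObj.star H) :=
    fun α => (SingleObj.mapHom G H f).mapIso α with hF
  have h1 : ∀ g, F (eG g) = eH (f g) := fun g => mapIso_mapHom_toAut f g
  have hf : (f : G → H) = eH.symm ∘ F ∘ eG := by
    funext g
    simp only [Function.comp_apply, h1, Equiv.symm_apply_apply]
  have hF' : F = eH ∘ f ∘ eG.symm := by
    funext α
    obtain ⟨g, rfl⟩ := eG.surjective α
    simp only [Function.comp_apply, Equiv.symm_apply_apply, h1]
  constructor
  · intro h
    rw [hf]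
    exact eH.symm.injective.comp (h.comp eG.injective)
  · intro h
    rw [hF']
    exact eH.injective.comp (h.comp eG.symm.injective)

variable {C : Type u₁} [Category.{v₁} C] {D : Type u₂} [Category.{v₂} D] {p : C ⥤ D}

/-- **The MODEL CASE of [IUTchI] Cor 5.3 at a one-object kind IS `DescendBijective`.**  If the `ℱ`-slot of a kit
at `v` is the kind `SingleObj (Aut(𝒞_v))` with reference object the unique object and base functor
`kindFunctor he hu` (the passage `𝒞_v ↦ 𝒟_v` on isomorphisms of categories; [FrdI] Cor 4.11 (i)/(iv) as the
binders `he`/`hu`), then the model-case hypothesis of `FKit.isomFtoDBijective_of_model` (p409092) at `v` —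
«`α ↦ (toD v)(α)` bijective on automorphisms of the reference object» — is EXACTLY «the natural map
`Aut(𝒞_v) → Aut(𝒟_v)` is bijective». ([IUTchI] Cor 5.3 p.144) [claim: Mochizuki2012, status: disputed] -/
theorem mapIso_kindFunctor_bijective_iff (he : HasUnder p p) (hu : UnderUnique p p) :
    Function.Bijective
        (fun α : SingleObj.star (CatAut C) ≅ SingleObj.star (CatAut C) =>
          (show SingleObj.star (CatAut D) ≅ SingleObj.star (CatAut D) from (kindFunctor he hu).mapIso α)) ↔
      DescendBijective p p he hu :=
  mapIso_mapHom_bijective_iff (descendHom he hu)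

/-- Injectivity half alone (the form the rigidity rows deliver): `α ↦ (kindFunctor he hu)(α)` is injective on
automorphisms of the unique object iff `descend he hu` is injective. ([IUTchI] Cor 5.3 p.144) [claim: Mochizuki2012, status: disputed] -/
theorem mapIso_kindFunctor_injective_iff (he : HasUnder p p) (hu : UnderUnique p p) :
    Function.Injective
        (fun α : SingleObj.star (CatAut C) ≅ SingleObj.star (CatAut C) =>
          (show SingleObj.star (CatAut D) ≅ SingleObj.star (CatAut D) from (kindFunctor he hu).mapIso α)) ↔
      Function.Injective (descend he hu) :=
  mapIso_mapHom_injective_iff (descendHom he hu)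

end KindSlot

/-! ### Print's reduction «let `α ∈ Ker(Aut(ℱ̲_v) → Aut(𝒟_v))` … wlog over the identity»: kernel form of injectivity -/

section KernelForm

variable {C₁ : Type u₁} [Category.{v₁} C₁] {C₂ : Type u₂} [Category.{v₂} C₂]
  {D₁ : Type w₁} [Category.{v₃} D₁] {D₂ : Type w₂} [Category.{v₄} D₂]
  {p₁ : C₁ ⥤ D₁} {p₂ : C₂ ⥤ D₂}

/-- If `Θ` lies under `Ψ` then `Θ⁻¹` lies under `Ψ⁻¹` (inverting the 1-commutative square).
([IUTchI] Cor 5.3 p.144) [claim: Mochizuki2012, status: disputed] -/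
theorem nonempty_liesUnder_symm {Ψ : C₁ ≌ C₂} {Θ : D₁ ≌ D₂} (h : Nonempty (LiesUnder p₁ p₂ Ψ Θ)) :
    Nonempty (LiesUnder p₂ p₁ Ψ.symm Θ.symm) := by
  obtain ⟨h⟩ := h
  exact ⟨(Iso.compInverseIso (H := Θ)
    (Iso.isoInverseComp (G := Ψ) h ≪≫ (Functor.associator Ψ.inverse p₁ Θ.functor).symm)).symm⟩

/-- **Kernel form of the injectivity of the natural map** (print, [IUTchI] p.144 l.43–45: «it remains to verify
injectivity. To this end, let `α ∈ Ker(Aut(ℱ̲_v) → Aut(𝒟_v))`. For simplicity, we suppose [without loss of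
generality] that `α` lies over the identity self-equivalence of `𝒟_v`. Then … `α` is [isomorphic to] the
identity»): `descend : Isom(C₁, C₂) → Isom(D₁, D₂)` is injective as soon as every self-equivalence of `C₁` lying
under the IDENTITY of `D₁` is isomorphic to the identity. ([IUTchI] Cor 5.3 p.144) [claim: Mochizuki2012, status: disputed] -/
theorem descend_injective_of_kernel_trivial (he : HasUnder p₁ p₂) (hu : UnderUnique p₁ p₂)
    (hker : ∀ Φ : C₁ ≌ C₁,
      Nonempty (LiesUnder p₁ p₁ Φ (CategoryTheory.Equivalence.refl (C := D₁))) → Nonempty (Φ.functor ≅ 𝟭 C₁)) :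
    Function.Injective (descend he hu) := by
  refine descend_injective_of_rigid he hu fun Ψ Ψ' Θ Θ' hΨ hΨ' hΘ => ?_
  obtain ⟨h⟩ := hΨ
  obtain ⟨h'⟩ := nonempty_liesUnder_symm hΨ'
  obtain ⟨j⟩ := hΘ
  -- `Φ := Ψ ∘ Ψ'⁻¹` lies under `Θ ∘ Θ'⁻¹ ≅ 𝟭`
  have hΦ : Nonempty (LiesUnder p₁ p₁ (Ψ.trans Ψ'.symm) (CategoryTheory.Equivalence.refl (C := D₁))) := by
    refine ⟨(h.trans h').ofIsoLower ?_⟩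
    -- (Θ.trans Θ'.symm).functor = Θ.functor ⋙ Θ'.inverse ≅ Θ'.functor ⋙ Θ'.inverse ≅ 𝟭
    exact Functor.isoWhiskerRight j Θ'.inverse ≪≫ Θ'.unitIso.symm
  obtain ⟨k⟩ := hker _ hΦ
  -- `Ψ ⋙ Ψ'⁻¹ ≅ 𝟭` ⇒ `Ψ ≅ Ψ'`
  refine ⟨?_⟩
  calc Ψ.functor ≅ Ψ.functor ⋙ 𝟭 C₂ := Ψ.functor.rightUnitor.symm
    _ ≅ Ψ.functor ⋙ (Ψ'.inverse ⋙ Ψ'.functor) := Functor.isoWhiskerLeft Ψ.functor Ψ'.counitIso.symm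
    _ ≅ (Ψ.functor ⋙ Ψ'.inverse) ⋙ Ψ'.functor := (Functor.associator _ _ _).symm
    _ ≅ 𝟭 C₁ ⋙ Ψ'.functor := Functor.isoWhiskerRight k Ψ'.functor
    _ ≅ Ψ'.functor := Ψ'.functor.leftUnitor

/-- The same for `Aut(−)`: the natural homomorphism `Aut(C) → Aut(D)` is injective as soon as its kernel — the
self-equivalences lying under the identity — consists of equivalences isomorphic to the identity.
([IUTchI] Cor 5.3 p.144) [claim: Mochizuki2012, status: disputed] -/
theorem descendHom_injective_of_kernel_trivial {C : Type u₁} [Category.{v₁} C] {D : Type w₁} [Category.{v₃} D]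
    {p : C ⥤ D} (he : HasUnder p p) (hu : UnderUnique p p)
    (hker : ∀ Φ : C ≌ C,
      Nonempty (LiesUnder p p Φ (CategoryTheory.Equivalence.refl (C := D))) → Nonempty (Φ.functor ≅ 𝟭 C)) :
    Function.Injective (descendHom he hu) :=
  descend_injective_of_kernel_trivial he hu hker

end KernelForm

end CatIsomorphism

end Literature.IUT.HodgeTheaters
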